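import Summits.QuantumAdvantage.QuantumAdvantage.Theorems.SosSandwichTransferPBMachineSplit
import Literature.Computability.QuantumComplexity.Forrelation
import HarnessLib

/-!
# Crux `TransferPB` (stmt-QuantumAdvantage-15238, route SosSandwich), line `birth` — the node-test encodings are injective and `nodeProblem` is a genuine promise problem

Support for the two remaining obligations (Q) `nodeProblem F r c k ∈ PromiseBQP` and (M) the transcript machine
(`Theorems/SosSandwichTransferPBMachineSplit.lean`): the instance encodings of
`Theorems/SosSandwichTransferPBMachineDefs.lean` are injective and the three kinds are tag-separated, so the
YES and NO sets of `nodeProblem` are DISJOINT (a necessary condition for `PromiseBQP` membership, and the fact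
the machine relies on when it reads one answer per instance).

* (`boolPair_inj` of `Forrelation.lean`: `⟨a, b⟩ = ⟨a', b'⟩ ↔ a = a' ∧ b = b'`);
* `bitString_injective`, `encPath_injective`;
* `encBlock_eq_iff`, `encSingle_eq_iff`, `encMean_eq_iff` (same input `x`), `x_eq_of_enc…` (the input is
  recovered), and the six cross-kind inequalities;
* **`nodeProblem_disjoint`** — `Disjoint (nodeProblem F r c k).yes (nodeProblem F r c k).no`.

All proved; no named fact. Source: S. Arora, B. Barak, *Computational Complexity* (2009), §0.1 (self-delimiting
pairing), as in `Literature/Computability/Complexity/BoolEncodings.lean`.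
-/

-- D-0017: single-conjunct summit ⇒ the duplicate `QuantumAdvantage.QuantumAdvantage` is mandated.
set_option linter.dupNamespace false

noncomputable section

namespace Summit.QuantumAdvantage.QuantumAdvantage.Cruxes.TransferPB.Birth

open Finset Literature.Computability.Cryptography Literature.Computability.Complexity
  Literature.Computability.QuantumComplexity

namespace SimTreePB

variable (F : QCircuitFamily cliffordT) (x : List Bool)

/-- Distinct relevant bits name distinct oracle strings. [folklore] -/
theorem bitString_injective : Function.Injective (bitString F x) := fun _ _ h =>
  (bitEquiv F x).symm.injective (Subtype.ext h)

/-- The path serialisation is injective. [folklore] -/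
theorem encPath_injective : ∀ ρ ρ' : List (Fin (numOracleBits F x) × Bool),
    encPath F x ρ = encPath F x ρ' → ρ = ρ'
  | [], [], _ => rfl
  | [], e' :: ρ', h => by
    have hl := congrArg List.length h
    simp [encPath, length_boolPair] at hl
    all_goals omega
  | e :: ρ, [], h => by
    have hl := congrArg List.length h
    simp [encPath, length_boolPair] at hl
  | e :: ρ, e' :: ρ', h => by
    simp only [encPath] at h
    obtain ⟨h1, h2⟩ := boolPair_inj.1 h
    obtain ⟨hb, hs⟩ := List.cons_eq_cons.1 h1
    have he : e = e' := Prod.ext (bitString_injective F x hs) hb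
    rw [he, encPath_injective ρ ρ' h2]

variable {F x}

/-- Same-input BLOCK instances coincide iff their data do. [folklore] -/
theorem encBlock_eq_iff {ρ ρ' : List (Fin (numOracleBits F x) × Bool)} {u u' : List Bool} :
    encBlock F x ρ u = encBlock F x ρ' u' ↔ ρ = ρ' ∧ u = u' := by
  constructor
  · intro h
    obtain ⟨-, h2⟩ := boolPair_inj.1 h
    obtain ⟨hp, hu⟩ := boolPair_inj.1 h2
    exact ⟨encPath_injective F x _ _ hp, by simpa using hu⟩
  · rintro ⟨rfl, rfl⟩; rfl

/-- Same-input SINGLE instances coincide iff their data do. [folklore] -/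
theorem encSingle_eq_iff {ρ ρ' : List (Fin (numOracleBits F x) × Bool)} {s s' : Fin (numOracleBits F x)} :
    encSingle F x ρ s = encSingle F x ρ' s' ↔ ρ = ρ' ∧ s = s' := by
  constructor
  · intro h
    obtain ⟨-, h2⟩ := boolPair_inj.1 h
    obtain ⟨hp, hs⟩ := boolPair_inj.1 h2
    refine ⟨encPath_injective F x _ _ hp, bitString_injective F x ?_⟩
    simpa using hs
  · rintro ⟨rfl, rfl⟩; rfl

/-- Same-input MEAN instances coincide iff their data do. [folklore] -/
theorem encMean_eq_iff {ρ ρ' : List (Fin (numOracleBits F x) × Bool)} {j j' : ℕ} :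
    encMean F x ρ j = encMean F x ρ' j' ↔ ρ = ρ' ∧ j = j' := by
  constructor
  · intro h
    obtain ⟨-, h2⟩ := boolPair_inj.1 h
    obtain ⟨hp, hj⟩ := boolPair_inj.1 h2
    refine ⟨encPath_injective F x _ _ hp, ?_⟩
    have := congrArg List.length (List.cons_eq_cons.1 hj).2
    simpa using this
  · rintro ⟨rfl, rfl⟩; rfl

/-- The input is recovered from a BLOCK instance. [folklore] -/
theorem x_eq_of_encBlock {x' : List Bool} {ρ : List (Fin (numOracleBits F x) × Bool)}
    {ρ' : List (Fin (numOracleBits F x') × Bool)} {u u' : List Bool}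
    (h : encBlock F x ρ u = encBlock F x' ρ' u') : x = x' :=
  (boolPair_inj.1 h).1

/-- The input is recovered from a SINGLE instance. [folklore] -/
theorem x_eq_of_encSingle {x' : List Bool} {ρ : List (Fin (numOracleBits F x) × Bool)}
    {ρ' : List (Fin (numOracleBits F x') × Bool)} {s : Fin (numOracleBits F x)} {s' : Fin (numOracleBits F x')}
    (h : encSingle F x ρ s = encSingle F x' ρ' s') : x = x' :=
  (boolPair_inj.1 h).1

/-- The input is recovered from a MEAN instance. [folklore] -/
theorem x_eq_of_encMean {x' : List Bool} {ρ : List (Fin (numOracleBits F x) × Bool)}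
    {ρ' : List (Fin (numOracleBits F x') × Bool)} {j j' : ℕ}
    (h : encMean F x ρ j = encMean F x' ρ' j') : x = x' :=
  (boolPair_inj.1 h).1

/-- BLOCK and SINGLE instances never coincide (tags `00` / `01`). [folklore] -/
theorem encBlock_ne_encSingle {x' : List Bool} {ρ : List (Fin (numOracleBits F x) × Bool)}
    {ρ' : List (Fin (numOracleBits F x') × Bool)} {u : List Bool} {s' : Fin (numOracleBits F x')} :
    encBlock F x ρ u ≠ encSingle F x' ρ' s' := by
  intro h
  obtain ⟨-, h2⟩ := boolPair_inj.1 h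
  obtain ⟨-, h3⟩ := boolPair_inj.1 h2
  simp at h3

/-- BLOCK and MEAN instances never coincide (tags `0…` / `1…`). [folklore] -/
theorem encBlock_ne_encMean {x' : List Bool} {ρ : List (Fin (numOracleBits F x) × Bool)}
    {ρ' : List (Fin (numOracleBits F x') × Bool)} {u : List Bool} {j' : ℕ} :
    encBlock F x ρ u ≠ encMean F x' ρ' j' := by
  intro h
  obtain ⟨-, h2⟩ := boolPair_inj.1 h
  obtain ⟨-, h3⟩ := boolPair_inj.1 h2
  simp at h3

/-- SINGLE and MEAN instances never coincide (tags `0…` / `1…`). [folklore] -/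
theorem encSingle_ne_encMean {x' : List Bool} {ρ : List (Fin (numOracleBits F x) × Bool)}
    {ρ' : List (Fin (numOracleBits F x') × Bool)} {s : Fin (numOracleBits F x)} {j' : ℕ} :
    encSingle F x ρ s ≠ encMean F x' ρ' j' := by
  intro h
  obtain ⟨-, h2⟩ := boolPair_inj.1 h
  obtain ⟨-, h3⟩ := boolPair_inj.1 h2
  simp at h3

/-- **`nodeProblem` is a genuine promise problem**: its YES and NO sets are disjoint (same-kind collisions force
equal data, and the thresholds `w/2 < w`, `(j−1)/40 < j/40` separate; different kinds never collide).
[folklore] -/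
theorem nodeProblem_disjoint (F : QCircuitFamily cliffordT) (r : Polynomial ℕ) (c k : ℕ) :
    Disjoint (nodeProblem F r c k).yes (nodeProblem F r c k).no := by
  intro w hwy hwn v hv
  have hy : v ∈ (nodeProblem F r c k).yes := hwy hv
  have hn : v ∈ (nodeProblem F r c k).no := hwn hv
  exfalso
  obtain ⟨x, ρ, hy⟩ := hy
  obtain ⟨x', ρ', hn⟩ := hn
  rcases hy with ⟨u, rfl, hyu⟩ | ⟨s, rfl, hys⟩ | ⟨j, rfl, hj1, hj40, hyj⟩
  · rcases hn with ⟨u', he, hnu⟩ | ⟨s', he, -⟩ | ⟨j', he, -⟩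
    · have hx := x_eq_of_encBlock he
      subst hx
      obtain ⟨rfl, rfl⟩ := encBlock_eq_iff.1 he
      have hw := pbThreshold_pos F x r c k
      linarith
    · exact encBlock_ne_encSingle he
    · exact encBlock_ne_encMean he
  · rcases hn with ⟨u', he, -⟩ | ⟨s', he, hns⟩ | ⟨j', he, -⟩
    · exact encBlock_ne_encSingle he.symm
    · have hx := x_eq_of_encSingle he
      subst hx
      obtain ⟨rfl, rfl⟩ := encSingle_eq_iff.1 he
      have hw := pbThreshold_pos F x r c k
      linarith
    · exact encSingle_ne_encMean he
  · rcases hn with ⟨u', he, -⟩ | ⟨s', he, -⟩ | ⟨j', he, hj1', hj40', hnj⟩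
    · exact encBlock_ne_encMean he.symm
    · exact encSingle_ne_encMean he.symm
    · have hx := x_eq_of_encMean he
      subst hx
      obtain ⟨rfl, rfl⟩ := encMean_eq_iff.1 he
      have : (j : ℝ) / 40 ≤ ((j : ℝ) - 1) / 40 := hyj.trans hnj
      linarith

end SimTreePB

end Summit.QuantumAdvantage.QuantumAdvantage.Cruxes.TransferPB.Birth

end
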